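import Summits.HodgeConjecture.HodgeConjecture.Theorems.VHCAbelianSchemesRoadSecantQuotientResidualLefschetzFibre
import Summits.HodgeConjecture.HodgeConjecture.Theorems.VHCAbelianSchemesRoadSecantQuotientAnchorPinnedDefsPrime
import Summits.HodgeConjecture.HodgeConjecture.Theorems.VHCAbelianSchemesRoadTwistedCarrierPrime
import HarnessLib

/-!
# Road b02 (`VHCAbelianSchemesRoad`, D-0059) — THE TWO SPECIAL-FIBRE CARRIER CONSTRUCTORS AND THE `(6,3)` RESIDUAL REDUCTIONS OF THIS LINEAGE
# READ AT THE PRIMED TWISTED DOOR `tw(AdmTw′)`, `AdmTw′ := gluableSigmaAdmissible ∨ bfSingleAdmissible′` (re-keyed crux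
# `SemiregularSheafRepresentativesTwPrimeAtDiag`, item stmt-HodgeConjecture-20707; aside stmt-HodgeConjecture-19787)

research route conditional on HC_CM; not a corollary; Q11.4-sentence-2 already refuted in dim ≥ 3.

FACT-FREE; `HC_CM` nowhere; no `def`; nothing of any landed file edited (ring2-b03 gen 85, lane R heir; LEAD 157's `DOOR-PRIME-PACKAGE.md`
36e61c73e912c4e1 §iv names exactly two landed statements whose primed twin is CONTENT rather than restriction —
`ellipticPowerCarrierAt63_twAdm_of_forall_exists_isISemiregular` (b03 g81, `…SecantQuotientResidualSpecialFibre`) and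
`lefschetzCarrierAt63_twAdm_of_forall_exists_isISemiregular` (b03 g82, `…SecantQuotientResidualLefschetzFibre`): both built the door's membership on
the index set `I = {3}`, which the primed Buchweitz–Flenner disjunct `bfSingleAdmissible′` (initial-segment conjunct, p537197) no longer admits.
The door-generic calculus is the companion `VHCAbelianSchemesRoadTwistedCarrierPrime` (this generation): on `I = {1, 2, 3}` the carrier must have
`κ₁ ∈ ℂθ` AND `κ₂ ∈ ℂθ²` besides `κ₃ = a·w + c₃·θ³` (`forall_lowerSides_of_anchoredCarrierAt_bfSingle'`: this is NECESSARY on the BF′ disjunct),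
the semiregularity asked is `{0,1,2}`-semiregularity (WEAKER than the `{2}`-semiregularity of the originals), and in Markman's normalisation
`B₀ = −c₁(F)/r` the degree-one side is automatic.

* §1 THE PRIMED TWINS at `tw C AdmTw′` (and every `Adm ⊇ bfSingleAdmissible′`): `ellipticPowerCarrierAt63_twisted_prime_of_forall_exists` ∕
  `…_twAdm'_…` — g81's hypothesis VERBATIM (`{2}`-semiregular `F`, rational algebraic `B₀`, `a ≠ 0`, `(e^{B₀} ch F)₃ = a·w + c·θ³`) PLUS the two
  side conditions `(e^{B₀} ch F)₁ = c₁·θ`, `(e^{B₀} ch F)₂ = c₂·θ²`; `lefschetzCarrierAt63_twisted_prime_of_forall_exists` ∕ `…_twAdm'_…` — the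
  same for g82's Lefschetz-fibre anchors (served classes `D³ ⊗ ℂ`, swapped to «algebraic classes» by `anchoredCarrierAt_lefschetz_iff_divisorial`).
* §2 THE MARKMAN-NORMALISED FORMS (no `B`-field, no degree-one side): `ellipticPowerCarrierAt63_twAdm'_of_forall_exists_markman`,
  `lefschetzCarrierAt63_twAdm'_of_forall_exists_markman` — «on every polarised elliptic-power (resp. divisor-generated) sixfold and every rational
  algebraic (resp. Lefschetz) `w`: a vector bundle `F` of rank `r ∈ ℚ^×`, `{0,1,2}`-semiregular, with `κ₂(F) ∈ ℂθ²`, `κ₃(F) = a·w + c·θ³`, `a ≠ 0`,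
  `κ = ch·e^{−ch₁/r}`» ⟹ the primed `(6,3)` carrier statement. THIS is the find-the-sheaf problem of lane R at the primed door.
* §3 THE PRIMED RESIDUAL REDUCTIONS, by 𝒪-genericity of g81∕g82's cell lemmas (`under_ellipticPowerFibre_of_ellipticPowerCarrierAt`,
  `under_lefschetzFibre_of_lefschetzCarrierAt`, `under_notLefschetz_of_under_notEllipticPower`) at `𝒪 := tw C AdmTw′`, concluding b06 g121's name
  `SecantQuotientResidual63PinnedPrime C` (= skeleton v3.2's stub 2b″′): **(b″′) ⟸ primed elliptic-power carriers ∧ the doubly residual at `AdmTw′`**,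
  **(b″′) ⟸ primed Lefschetz-fibre carriers ∧ (no pinned-served, no Lefschetz fibre) at `AdmTw′`** (and the `…_notEllipticPower` form), and the primed
  rung from (a″′) with either pair (`lefAtExceptionalRegimeSixfoldMiddle_twPrime_of_pinnedPrime`).

HONEST STATUS of the hypotheses (unchanged from g81–g83 and ab-andre-2's PART AE, now sharper): split ∕ semi-homogeneous ∕ `𝒪_Z`-summand carriers
are excluded everywhere on the Weil components (INF-NL-UNIFORM N1–N3, b06 g121 ×2; PART AE.1–AE.6); what survives is the `ch`-condition of FILTERED
carriers (N5), to which the primed door adds `κ₂(F) ∈ ℂθ²` — automatic to first order along a very general `U(3,3)` pencil (inf-NL in degree 4 is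
`ℂθ²`), a genuine constraint at the special fibre itself. Nothing here says any carrier statement, (a″′), (b″′), any cell, rung, crux, K-SR♭∃, VHC,
`HC_AV` or HC holds; that any pencil of the residual HAS an elliptic-power or Lefschetz fibre is not claimed (bookkeeping partition, as in g81∕g82).
References: [cite: BuchweitzFlenner2003, Def. 4.1, §5 (I-semiregular), Thm. 5.1] [cite: Pridham2024Semiregularity, Cor. 2.25 and Rem. 2.26]
[cite: Markman2025SecantWeil, §1.1, §1.5, Thm. 1.4.1, Thm. 1.5.1 and §7.3] [cite: vanGeemen1994HodgeAV, §2.4, Thm. 4.3, Thm. 4.11, Lemma 5.2 and 5.4]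
[cite: MoonenZarhin1999LowDim, (2.1), §2 (2.2) and Cor. 3.9] [cite: MumfordAV1970, §16] [cite: Bloch1972Semiregularity, Remark (7.5)].
-/

noncomputable section

open CategoryTheory CategoryTheory.Limits AlgebraicGeometry Topology

-- the cell's namespace repeats the summit name (`Summit.HodgeConjecture.HodgeConjecture…`), as in every `Ring2*` file
set_option linter.dupNamespace false

namespace Summit.HodgeConjecture.HodgeConjecture.Ring2.SemiregularRepresentatives

open Literature.AlgebraicGeometry Literature.AlgebraicGeometry.Motives Literature.AlgebraicGeometry.Modules
open Literature.AlgebraicGeometry.HodgeTheory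
open Literature.AlgebraicTopology.SingularHomology
open Literature.Barriers.HodgeConjecture (divisorClassesSpan)
open Summit.Ventures.HSemireg (ObjClass)

/-- `{2}`-semiregularity (the originals' hypothesis, `{q | q+1 ∈ {3}} = {2}`) implies the `{0,1,2}`-semiregularity the primed constructors ask.
[cite: BuchweitzFlenner2003, §5 (I-semiregular)] -/
private theorem isISemiregular_Iio_three_of_singleton {X : SchemeOver ℂ} {F : X.left.Modules} (hF : IsFiniteLocallyFree F)
    (hsr : IsISemiregular hF {q | q + 1 ∈ ({3} : Finset ℕ)}) : IsISemiregular hF (Set.Iio 3) := by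
  rw [← setOf_succ_mem_Icc]
  exact hsr.mono hF (setOf_succ_mem_singleton_subset 3)

/-- The anchors of both families are smooth projective of dimension `n` (a copy of an abelian `n`-fold). [cite: MumfordAV1970, §16] -/
private theorem isSmoothProjective_of_iso_abelian {n : ℕ} {X : SchemeOver ℂ} {A₀ : AbelianVariety ℂ} (hd : A₀.dim = n) (e₀ : A₀.X ≅ X) :
    IsSmoothProjective n X := by
  subst hd
  exact (AbelianVariety.isSmoothProjective_holds (A := A₀)).of_iso e₀

/-! ## §1 The primed twins of the two content constructors: g81∕g82's hypotheses plus the side conditions in degrees `1` and `2` -/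

section Twins

variable {C : ChernCharacterBetti} {Adm : PerfectAdmissibility} {n : ℕ}

/-- **ELLIPTIC-POWER CARRIERS FOR EVERY `Adm ⊇ bfSingleAdmissible′` FROM `{2}`-SEMIREGULAR VECTOR BUNDLES WITH ALL THREE CLASSES PRESCRIBED**
(the primed twin of `ellipticPowerCarrierAt63_twAdm_of_forall_exists_isISemiregular`, index set `I = {1,2,3}`): for every `X ≅ A₀ ~ E₀^{N+1}` of
dimension `n`, polarisation class `θ`, rational algebraic `w ∈ H⁶`: a finite locally free `F`, a rational algebraic `B₀`, `a ≠ 0`, `c`, with `σ₂`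
injective on `Ext²(F,F)`, `(e^{B₀} ch F)₃ = a·w + c·θ³` — AS IN g81 — AND scalars `c₁, c₂` with `(e^{B₀} ch F)₁ = c₁·θ`, `(e^{B₀} ch F)₂ = c₂·θ²`.
[cite: BuchweitzFlenner2003, §5 (I-semiregular) and Thm. 5.1] [cite: Pridham2024Semiregularity, Cor. 2.25 and Rem. 2.26]
[cite: vanGeemen1994HodgeAV, Thm. 4.3] [cite: Bloch1972Semiregularity, Remark (7.5)] -/
theorem ellipticPowerCarrierAt_twisted_prime_of_forall_exists (hAdm' : ∀ n X₀ I E, bfSingleAdmissible' n X₀ I E → Adm n X₀ I E)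
    (h : ∀ (X : SchemeOver ℂ) (θ : complexBetti X 2),
      ((∃ (A₀ E₀ : AbelianVariety ℂ) (N : ℕ), A₀.dim = n ∧ E₀.dim = 1 ∧ A₀.IsIsogenous (E₀.powSucc N) ∧ Nonempty (A₀.X ≅ X)) ∧
        IsPolarizationClass n X θ) →
      ∀ w : complexBetti X (2 * 3), w ∈ algebraicClasses X 3 → IsRationalClass w →
      ∃ (F : X.left.Modules) (hF : IsFiniteLocallyFree F) (B₀ : complexBetti X 2) (a c : ℂ),
        (IsISemiregular hF {q | q + 1 ∈ ({3} : Finset ℕ)} ∧ IsRationalClass B₀ ∧ B₀ ∈ algebraicClasses X 1 ∧ a ≠ 0 ∧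
          expTwistCh C X B₀ F 3 = a • w + c • cupPowTwo θ 3) ∧
        ∃ c₁ c₂ : ℂ, expTwistCh C X B₀ F 1 = c₁ • cupPowTwo θ 1 ∧ expTwistCh C X B₀ F 2 = c₂ • cupPowTwo θ 2) :
    AnchoredCarrierAt (twistedReflexiveClass C Adm) n 3
      (fun X θ ↦ (∃ (A₀ E₀ : AbelianVariety ℂ) (N : ℕ), A₀.dim = n ∧ E₀.dim = 1 ∧ A₀.IsIsogenous (E₀.powSucc N) ∧
        Nonempty (A₀.X ≅ X)) ∧ IsPolarizationClass n X θ)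
      (fun X _ ↦ (algebraicClasses X 3 : Set (complexBetti X (2 * 3)))) := by
  refine anchoredCarrierAt_twisted_of_forall_exists_isISemiregular_Icc (by norm_num) hAdm' fun X θ hXθ w hw hwQ ↦ ?_
  obtain ⟨F, hF, B₀, a, c, ⟨hsr, hBQ, hBalg, ha, hκ3⟩, c₁, c₂, hκ1, hκ2⟩ := h X θ hXθ w hw hwQ
  refine ⟨F, hF, B₀, a, fun q ↦ if q = 1 then c₁ else if q = 2 then c₂ else c, isISemiregular_Iio_three_of_singleton hF hsr,
    hBQ, hBalg, ha, ?_, fun q h1 hq3 ↦ ?_⟩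
  · dsimp only
    rw [if_neg (by decide), if_neg (by decide)]
    exact hκ3
  · interval_cases q
    · dsimp only
      rw [if_pos rfl]
      exact hκ1
    · dsimp only
      rw [if_neg (by decide), if_pos rfl]
      exact hκ2

/-- **Instance at the re-keyed crux's door `tw C AdmTw′` and `(6,3)`** — the primed twin of `ellipticPowerCarrierAt63_twAdm_of_forall_exists_isISemiregular`
(g81's hypotheses verbatim + the two side conditions; `hAdm' := Or.inr`). [cite: BuchweitzFlenner2003, §5 (I-semiregular) and Thm. 5.1]
[cite: Pridham2024Semiregularity, Cor. 2.25 and Rem. 2.26] [cite: MumfordAV1970, §16] [cite: Mukai1978, §5–§6] -/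
theorem ellipticPowerCarrierAt63_twAdm'_of_forall_exists_isISemiregular
    (h : ∀ (X : SchemeOver ℂ) (θ : complexBetti X 2),
      ((∃ (A₀ E₀ : AbelianVariety ℂ) (N : ℕ), A₀.dim = 6 ∧ E₀.dim = 1 ∧ A₀.IsIsogenous (E₀.powSucc N) ∧ Nonempty (A₀.X ≅ X)) ∧
        IsPolarizationClass 6 X θ) →
      ∀ w : complexBetti X (2 * 3), w ∈ algebraicClasses X 3 → IsRationalClass w →
      ∃ (F : X.left.Modules) (hF : IsFiniteLocallyFree F) (B₀ : complexBetti X 2) (a c : ℂ),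
        (IsISemiregular hF {q | q + 1 ∈ ({3} : Finset ℕ)} ∧ IsRationalClass B₀ ∧ B₀ ∈ algebraicClasses X 1 ∧ a ≠ 0 ∧
          expTwistCh C X B₀ F 3 = a • w + c • cupPowTwo θ 3) ∧
        ∃ c₁ c₂ : ℂ, expTwistCh C X B₀ F 1 = c₁ • cupPowTwo θ 1 ∧ expTwistCh C X B₀ F 2 = c₂ • cupPowTwo θ 2) :
    AnchoredCarrierAt (Literature.AlgebraicGeometry.HodgeTheory.twistedReflexiveClass C
        (fun n X₀ I E => Summit.Ventures.HSemireg.gluableSigmaAdmissible n X₀ I E ∨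
          Literature.AlgebraicGeometry.HodgeTheory.bfSingleAdmissible' n X₀ I E)) 6 3
      (fun X θ ↦ (∃ (A₀ E₀ : AbelianVariety ℂ) (N : ℕ), A₀.dim = 6 ∧ E₀.dim = 1 ∧ A₀.IsIsogenous (E₀.powSucc N) ∧
        Nonempty (A₀.X ≅ X)) ∧ IsPolarizationClass 6 X θ)
      (fun X _ ↦ (algebraicClasses X 3 : Set (complexBetti X (2 * 3)))) :=
  ellipticPowerCarrierAt_twisted_prime_of_forall_exists (fun _ _ _ _ h ↦ Or.inr h) h

/-- **LEFSCHETZ-FIBRE CARRIERS FOR EVERY `Adm ⊇ bfSingleAdmissible′` FROM `{2}`-SEMIREGULAR VECTOR BUNDLES WITH ALL THREE CLASSES PRESCRIBED**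
(the primed twin of `lefschetzCarrierAt_twisted_of_forall_exists_isISemiregular` at `p = 3`): for every `X ≅ A₀`, `B•(A₀) = D•(A₀)`, polarisation
class `θ`, rational LEFSCHETZ `w ∈ D³(X) ⊗ ℂ`: g82's datum `(F, B₀, a, c)` AND the side conditions in degrees `1`, `2`; served classes «algebraic»
by `anchoredCarrierAt_lefschetz_iff_divisorial`. [cite: BuchweitzFlenner2003, §5 (I-semiregular) and Thm. 5.1]
[cite: Pridham2024Semiregularity, Cor. 2.25 and Rem. 2.26] [cite: vanGeemen1994HodgeAV, §2.4] [cite: MoonenZarhin1999LowDim, §2 (2.2)] -/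
theorem lefschetzCarrierAt_twisted_prime_of_forall_exists (hAdm' : ∀ n X₀ I E, bfSingleAdmissible' n X₀ I E → Adm n X₀ I E)
    (h : ∀ (X : SchemeOver ℂ) (θ : complexBetti X 2),
      ((∃ A₀ : AbelianVariety ℂ, A₀.dim = n ∧ IsDivisorGenerated A₀ ∧ Nonempty (A₀.X ≅ X)) ∧ IsPolarizationClass n X θ) →
      ∀ w : complexBetti X (2 * 3), w ∈ divisorClassesSpan X n 3 → IsRationalClass w →
      ∃ (F : X.left.Modules) (hF : IsFiniteLocallyFree F) (B₀ : complexBetti X 2) (a c : ℂ),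
        (IsISemiregular hF {q | q + 1 ∈ ({3} : Finset ℕ)} ∧ IsRationalClass B₀ ∧ B₀ ∈ algebraicClasses X 1 ∧ a ≠ 0 ∧
          expTwistCh C X B₀ F 3 = a • w + c • cupPowTwo θ 3) ∧
        ∃ c₁ c₂ : ℂ, expTwistCh C X B₀ F 1 = c₁ • cupPowTwo θ 1 ∧ expTwistCh C X B₀ F 2 = c₂ • cupPowTwo θ 2) :
    AnchoredCarrierAt (twistedReflexiveClass C Adm) n 3
      (fun X θ ↦ (∃ A₀ : AbelianVariety ℂ, A₀.dim = n ∧ IsDivisorGenerated A₀ ∧ Nonempty (A₀.X ≅ X)) ∧ IsPolarizationClass n X θ)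
      (fun X _ ↦ (algebraicClasses X 3 : Set (complexBetti X (2 * 3)))) := by
  refine anchoredCarrierAt_lefschetz_iff_divisorial.2
    (anchoredCarrierAt_twisted_of_forall_exists_isISemiregular_Icc (by norm_num) hAdm' fun X θ hXθ w hw hwQ ↦ ?_)
  obtain ⟨F, hF, B₀, a, c, ⟨hsr, hBQ, hBalg, ha, hκ3⟩, c₁, c₂, hκ1, hκ2⟩ := h X θ hXθ w hw hwQ
  refine ⟨F, hF, B₀, a, fun q ↦ if q = 1 then c₁ else if q = 2 then c₂ else c, isISemiregular_Iio_three_of_singleton hF hsr,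
    hBQ, hBalg, ha, ?_, fun q h1 hq3 ↦ ?_⟩
  · dsimp only
    rw [if_neg (by decide), if_neg (by decide)]
    exact hκ3
  · interval_cases q
    · dsimp only
      rw [if_pos rfl]
      exact hκ1
    · dsimp only
      rw [if_neg (by decide), if_pos rfl]
      exact hκ2

/-- **Instance at `tw C AdmTw′` and `(6,3)`** — the primed twin of `lefschetzCarrierAt63_twAdm_of_forall_exists_isISemiregular` (the QM-cube `S_δ³`,
`E₀⁶`, `T²`-points and their isogeny classes). [cite: BuchweitzFlenner2003, §5 (I-semiregular) and Thm. 5.1] [cite: Pridham2024Semiregularity, Cor. 2.25 and Rem. 2.26]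
[cite: MoonenZarhin1999LowDim, §2 (2.2)] [cite: MumfordAV1970, §16] -/
theorem lefschetzCarrierAt63_twAdm'_of_forall_exists_isISemiregular
    (h : ∀ (X : SchemeOver ℂ) (θ : complexBetti X 2),
      ((∃ A₀ : AbelianVariety ℂ, A₀.dim = 6 ∧ IsDivisorGenerated A₀ ∧ Nonempty (A₀.X ≅ X)) ∧ IsPolarizationClass 6 X θ) →
      ∀ w : complexBetti X (2 * 3), w ∈ divisorClassesSpan X 6 3 → IsRationalClass w →
      ∃ (F : X.left.Modules) (hF : IsFiniteLocallyFree F) (B₀ : complexBetti X 2) (a c : ℂ),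
        (IsISemiregular hF {q | q + 1 ∈ ({3} : Finset ℕ)} ∧ IsRationalClass B₀ ∧ B₀ ∈ algebraicClasses X 1 ∧ a ≠ 0 ∧
          expTwistCh C X B₀ F 3 = a • w + c • cupPowTwo θ 3) ∧
        ∃ c₁ c₂ : ℂ, expTwistCh C X B₀ F 1 = c₁ • cupPowTwo θ 1 ∧ expTwistCh C X B₀ F 2 = c₂ • cupPowTwo θ 2) :
    AnchoredCarrierAt (Literature.AlgebraicGeometry.HodgeTheory.twistedReflexiveClass C
        (fun n X₀ I E => Summit.Ventures.HSemireg.gluableSigmaAdmissible n X₀ I E ∨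
          Literature.AlgebraicGeometry.HodgeTheory.bfSingleAdmissible' n X₀ I E)) 6 3
      (fun X θ ↦ (∃ A₀ : AbelianVariety ℂ, A₀.dim = 6 ∧ IsDivisorGenerated A₀ ∧ Nonempty (A₀.X ≅ X)) ∧ IsPolarizationClass 6 X θ)
      (fun X _ ↦ (algebraicClasses X 3 : Set (complexBetti X (2 * 3)))) :=
  lefschetzCarrierAt_twisted_prime_of_forall_exists (fun _ _ _ _ h ↦ Or.inr h) h

end Twins

/-! ## §2 The Markman-normalised forms: `κ = ch·e^{−ch₁/r}`, no `B`-field, no degree-one side -/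

section Markman

variable {C : ChernCharacterBetti}

/-- **THE `(6,3)` FIND-THE-SHEAF PROBLEM AT ELLIPTIC-POWER SIXFOLDS FOR THE PRIMED DOOR, IN MARKMAN'S NORMALISATION**: if on every polarised
`(X, θ)` with `X ≅ A₀ ~ E₀^{N+1}`, `dim A₀ = 6`, every rational algebraic `w ∈ H⁶` admits a finite locally free `F` of rank `r ∈ ℚ^×`
(`ch₀(F) = r·1`), `{0,1,2}`-semiregular, with `κ₂(F) = c₂·θ²` and `κ₃(F) = a·w + c₃·θ³`, `a ≠ 0`, where `κ(F) = ch(F)·e^{−ch₁(F)/r}`, then the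
elliptic-power carrier statement holds for `tw C AdmTw′` (`κ₁(F) = 0` and `B₀ = −ch₁/r` rational algebraic are automatic).
[cite: Markman2025SecantWeil, §1.1, §7.3 and Lemma 9.3.6] [cite: BuchweitzFlenner2003, §5 (I-semiregular) and Thm. 5.1]
[cite: Pridham2024Semiregularity, Cor. 2.25 and Rem. 2.26] [cite: vanGeemen1994HodgeAV, Thm. 4.3] -/
theorem ellipticPowerCarrierAt63_twAdm'_of_forall_exists_markman
    (h : ∀ (X : SchemeOver ℂ) (θ : complexBetti X 2),
      ((∃ (A₀ E₀ : AbelianVariety ℂ) (N : ℕ), A₀.dim = 6 ∧ E₀.dim = 1 ∧ A₀.IsIsogenous (E₀.powSucc N) ∧ Nonempty (A₀.X ≅ X)) ∧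
        IsPolarizationClass 6 X θ) →
      ∀ w : complexBetti X (2 * 3), w ∈ algebraicClasses X 3 → IsRationalClass w →
      ∃ (F : X.left.Modules) (hF : IsFiniteLocallyFree F) (r : ℚ) (a c₂ c₃ : ℂ),
        r ≠ 0 ∧ C.ch X F 0 = (r : ℂ) • singularCohomology.one ℂ (ComplexPoints X) ∧ IsISemiregular hF (Set.Iio 3) ∧ a ≠ 0 ∧
        expTwistCh C X (-(((r : ℂ))⁻¹ • C.ch X F 1)) F 2 = c₂ • cupPowTwo θ 2 ∧
        expTwistCh C X (-(((r : ℂ))⁻¹ • C.ch X F 1)) F 3 = a • w + c₃ • cupPowTwo θ 3) :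
    AnchoredCarrierAt (Literature.AlgebraicGeometry.HodgeTheory.twistedReflexiveClass C
        (fun n X₀ I E => Summit.Ventures.HSemireg.gluableSigmaAdmissible n X₀ I E ∨
          Literature.AlgebraicGeometry.HodgeTheory.bfSingleAdmissible' n X₀ I E)) 6 3
      (fun X θ ↦ (∃ (A₀ E₀ : AbelianVariety ℂ) (N : ℕ), A₀.dim = 6 ∧ E₀.dim = 1 ∧ A₀.IsIsogenous (E₀.powSucc N) ∧
        Nonempty (A₀.X ≅ X)) ∧ IsPolarizationClass 6 X θ)
      (fun X _ ↦ (algebraicClasses X 3 : Set (complexBetti X (2 * 3)))) := by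
  refine anchoredCarrierAt_twisted_of_forall_exists_markman (by norm_num) (fun _ _ _ _ h ↦ Or.inr h)
    (fun X θ ⟨⟨A₀, _, _, hd, _, _, ⟨e₀⟩⟩, _⟩ ↦ isSmoothProjective_of_iso_abelian hd e₀) fun X θ hXθ w hw hwQ ↦ ?_
  obtain ⟨F, hF, r, a, c₂, c₃, hr, h0, hsr, ha, hκ2, hκ3⟩ := h X θ hXθ w hw hwQ
  refine ⟨F, hF, r, a, fun q ↦ if q = 2 then c₂ else c₃, hr, h0, hsr, ha, ?_, fun q h2 hq3 ↦ ?_⟩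
  · dsimp only
    rw [if_neg (by decide)]
    exact hκ3
  · interval_cases q
    dsimp only
    rw [if_pos rfl]
    exact hκ2

/-- **THE SAME AT LEFSCHETZ-FIBRE SIXFOLDS** (`X ≅ A₀`, `B•(A₀) = D•(A₀)`; served classes the rational Lefschetz classes `w ∈ D³(X) ⊗ ℂ` — for the
Weil residual: the Lefschetz limit of the Weil class at an `S_δ³`-point): rank-`r` bundles, `{0,1,2}`-semiregular, `κ₂(F) ∈ ℂθ²`,
`κ₃(F) = a·w + c₃·θ³` in Markman's normalisation ⟹ the Lefschetz-fibre carrier statement for `tw C AdmTw′`.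
[cite: Markman2025SecantWeil, §1.1, §7.3 and Lemma 9.3.6] [cite: BuchweitzFlenner2003, §5 (I-semiregular) and Thm. 5.1]
[cite: MoonenZarhin1999LowDim, §2 (2.2)] [cite: vanGeemen1994HodgeAV, §2.4] -/
theorem lefschetzCarrierAt63_twAdm'_of_forall_exists_markman
    (h : ∀ (X : SchemeOver ℂ) (θ : complexBetti X 2),
      ((∃ A₀ : AbelianVariety ℂ, A₀.dim = 6 ∧ IsDivisorGenerated A₀ ∧ Nonempty (A₀.X ≅ X)) ∧ IsPolarizationClass 6 X θ) →
      ∀ w : complexBetti X (2 * 3), w ∈ divisorClassesSpan X 6 3 → IsRationalClass w →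
      ∃ (F : X.left.Modules) (hF : IsFiniteLocallyFree F) (r : ℚ) (a c₂ c₃ : ℂ),
        r ≠ 0 ∧ C.ch X F 0 = (r : ℂ) • singularCohomology.one ℂ (ComplexPoints X) ∧ IsISemiregular hF (Set.Iio 3) ∧ a ≠ 0 ∧
        expTwistCh C X (-(((r : ℂ))⁻¹ • C.ch X F 1)) F 2 = c₂ • cupPowTwo θ 2 ∧
        expTwistCh C X (-(((r : ℂ))⁻¹ • C.ch X F 1)) F 3 = a • w + c₃ • cupPowTwo θ 3) :
    AnchoredCarrierAt (Literature.AlgebraicGeometry.HodgeTheory.twistedReflexiveClass C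
        (fun n X₀ I E => Summit.Ventures.HSemireg.gluableSigmaAdmissible n X₀ I E ∨
          Literature.AlgebraicGeometry.HodgeTheory.bfSingleAdmissible' n X₀ I E)) 6 3
      (fun X θ ↦ (∃ A₀ : AbelianVariety ℂ, A₀.dim = 6 ∧ IsDivisorGenerated A₀ ∧ Nonempty (A₀.X ≅ X)) ∧ IsPolarizationClass 6 X θ)
      (fun X _ ↦ (algebraicClasses X 3 : Set (complexBetti X (2 * 3)))) := by
  refine anchoredCarrierAt_lefschetz_iff_divisorial.2
    (anchoredCarrierAt_twisted_of_forall_exists_markman (by norm_num) (fun _ _ _ _ h ↦ Or.inr h)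
      (fun X θ ⟨⟨A₀, hd, _, ⟨e₀⟩⟩, _⟩ ↦ isSmoothProjective_of_iso_abelian hd e₀) fun X θ hXθ w hw hwQ ↦ ?_)
  obtain ⟨F, hF, r, a, c₂, c₃, hr, h0, hsr, ha, hκ2, hκ3⟩ := h X θ hXθ w hw hwQ
  refine ⟨F, hF, r, a, fun q ↦ if q = 2 then c₂ else c₃, hr, h0, hsr, ha, ?_, fun q h2 hq3 ↦ ?_⟩
  · dsimp only
    rw [if_neg (by decide)]
    exact hκ3
  · interval_cases q
    dsimp only
    rw [if_pos rfl]
    exact hκ2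

end Markman

/-! ## §3 The primed `(6,3)` residual reductions: (b″′) ⟸ primed special-fibre carriers ∧ the doubly residual at `tw C AdmTw′` -/

section Residual

variable {C : ChernCharacterBetti}

/-- **(b″′) ⟸ PRIMED ELLIPTIC-POWER CARRIERS ∧ THE DOUBLY RESIDUAL CELL AT `tw C AdmTw′`** (the primed twin of
`secantQuotientResidual63Pinned_of_ellipticPowerCarrierAt_of_under_not_not`): if at every polarised elliptic-power sixfold every rational algebraic
`w` has an `AdmTw′`-admissible carrier (§1∕§2: all three classes prescribed), AND the primed cell `(6,3)` holds on the pencils with NO pinned-served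
fibre AND NO elliptic-power fibre, then `SecantQuotientResidual63PinnedPrime C` (skeleton v3.2's stub 2b″′). By excluded middle on «some fibre is an
elliptic power» and g81's 𝒪-generic `under_ellipticPowerFibre_of_ellipticPowerCarrierAt`. [cite: vanGeemen1994HodgeAV, Thm. 4.3, Thm. 4.11 and Lemma 5.2]
[cite: Markman2025SecantWeil, Thm. 1.5.1 and §1.5] [cite: Bloch1972Semiregularity, Remark (7.5)] [cite: MoonenZarhin1999LowDim, Cor. 3.9] -/
theorem secantQuotientResidual63PinnedPrime_of_ellipticPowerCarrierAt_of_under_not_not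
    (hE : AnchoredCarrierAt (Literature.AlgebraicGeometry.HodgeTheory.twistedReflexiveClass C
        (fun n X₀ I E => Summit.Ventures.HSemireg.gluableSigmaAdmissible n X₀ I E ∨
          Literature.AlgebraicGeometry.HodgeTheory.bfSingleAdmissible' n X₀ I E)) 6 3
      (fun X θ ↦ (∃ (A₀ E₀ : AbelianVariety ℂ) (N : ℕ), A₀.dim = 6 ∧ E₀.dim = 1 ∧ A₀.IsIsogenous (E₀.powSucc N) ∧
        Nonempty (A₀.X ≅ X)) ∧ IsPolarizationClass 6 X θ)
      (fun X _ ↦ (algebraicClasses X 3 : Set (complexBetti X (2 * 3)))))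
    (hR : LefAtExceptionalRegimeAtUnder (Literature.AlgebraicGeometry.HodgeTheory.twistedReflexiveClass C
        (fun n X₀ I E => Summit.Ventures.HSemireg.gluableSigmaAdmissible n X₀ I E ∨
          Literature.AlgebraicGeometry.HodgeTheory.bfSingleAdmissible' n X₀ I E)) 6 3
      (fun _ S f W ↦ ¬ HasServedFibre 6 3 (fun X θ ↦ secantQuotientAnchorsPinned X θ)
          (fun X θ ↦ secantQuotientServedClassesPinned X θ) f W ∧
        ¬ ∃ (t : ComplexPoints S) (A₀ E₀ : AbelianVariety ℂ) (N : ℕ),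
          A₀.dim = 6 ∧ E₀.dim = 1 ∧ A₀.IsIsogenous (E₀.powSucc N) ∧ Nonempty (A₀.X ≅ fiberOver f t))) :
    SecantQuotientResidual63PinnedPrime C := by
  intro 𝒳 S f hf h𝒳 hirr haff hsm hdim hab hsec W hW s₀ halg hexc hns
  by_cases hell : ∃ (t : ComplexPoints S) (A₀ E₀ : AbelianVariety ℂ) (N : ℕ),
      A₀.dim = 6 ∧ E₀.dim = 1 ∧ A₀.IsIsogenous (E₀.powSucc N) ∧ Nonempty (A₀.X ≅ fiberOver f t)
  · exact under_ellipticPowerFibre_of_ellipticPowerCarrierAt hE f hf h𝒳 hirr haff hsm hdim hab hsec W hW s₀ halg hexc hell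
  · exact hR f hf h𝒳 hirr haff hsm hdim hab hsec W hW s₀ halg hexc ⟨hns, hell⟩

/-- **(b″′) ⟸ PRIMED LEFSCHETZ-FIBRE CARRIERS ∧ THE RESIDUAL ON PENCILS WITH NO PINNED-SERVED AND NO LEFSCHETZ FIBRE AT `tw C AdmTw′`** (the primed
twin of `secantQuotientResidual63Pinned_of_lefschetzCarrierAt_of_under_not_not`; the QM-cube curves `S_δ³` of the non-split `(3,d,δ)` components are in
the first conjunct's charge). [cite: vanGeemen1994HodgeAV, Thm. 4.11, 5.2 and 5.4] [cite: Markman2025SecantWeil, Thm. 1.5.1 and §1.5]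
[cite: MoonenZarhin1999LowDim, §2 (2.2)] [cite: Bloch1972Semiregularity, Remark (7.5)] -/
theorem secantQuotientResidual63PinnedPrime_of_lefschetzCarrierAt_of_under_not_not
    (hL : AnchoredCarrierAt (Literature.AlgebraicGeometry.HodgeTheory.twistedReflexiveClass C
        (fun n X₀ I E => Summit.Ventures.HSemireg.gluableSigmaAdmissible n X₀ I E ∨
          Literature.AlgebraicGeometry.HodgeTheory.bfSingleAdmissible' n X₀ I E)) 6 3
      (fun X θ ↦ (∃ A₀ : AbelianVariety ℂ, A₀.dim = 6 ∧ IsDivisorGenerated A₀ ∧ Nonempty (A₀.X ≅ X)) ∧ IsPolarizationClass 6 X θ)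
      (fun X _ ↦ (algebraicClasses X 3 : Set (complexBetti X (2 * 3)))))
    (hR : LefAtExceptionalRegimeAtUnder (Literature.AlgebraicGeometry.HodgeTheory.twistedReflexiveClass C
        (fun n X₀ I E => Summit.Ventures.HSemireg.gluableSigmaAdmissible n X₀ I E ∨
          Literature.AlgebraicGeometry.HodgeTheory.bfSingleAdmissible' n X₀ I E)) 6 3
      (fun _ S f W ↦ ¬ HasServedFibre 6 3 (fun X θ ↦ secantQuotientAnchorsPinned X θ)
          (fun X θ ↦ secantQuotientServedClassesPinned X θ) f W ∧
        ¬ ∃ (t : ComplexPoints S) (A₀ : AbelianVariety ℂ), A₀.dim = 6 ∧ IsDivisorGenerated A₀ ∧ Nonempty (A₀.X ≅ fiberOver f t))) :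
    SecantQuotientResidual63PinnedPrime C := by
  intro 𝒳 S f hf h𝒳 hirr haff hsm hdim hab hsec W hW s₀ halg hexc hns
  by_cases hlef : ∃ (t : ComplexPoints S) (A₀ : AbelianVariety ℂ), A₀.dim = 6 ∧ IsDivisorGenerated A₀ ∧ Nonempty (A₀.X ≅ fiberOver f t)
  · exact under_lefschetzFibre_of_lefschetzCarrierAt hL f hf h𝒳 hirr haff hsm hdim hab hsec W hW s₀ halg hexc hlef
  · exact hR f hf h𝒳 hirr haff hsm hdim hab hsec W hW s₀ halg hexc ⟨hns, hlef⟩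

/-- **… with the residual hypothesis in g81's `…_notEllipticPower` form** (no stronger an ask: an elliptic-power fibre is a Lefschetz fibre,
`under_notLefschetz_of_under_notEllipticPower`). [cite: MoonenZarhin1999LowDim, Thm. 0.1 (4)] [cite: Bloch1972Semiregularity, Remark (7.5)] -/
theorem secantQuotientResidual63PinnedPrime_of_lefschetzCarrierAt_of_under_not_notEllipticPower
    (hL : AnchoredCarrierAt (Literature.AlgebraicGeometry.HodgeTheory.twistedReflexiveClass C
        (fun n X₀ I E => Summit.Ventures.HSemireg.gluableSigmaAdmissible n X₀ I E ∨
          Literature.AlgebraicGeometry.HodgeTheory.bfSingleAdmissible' n X₀ I E)) 6 3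
      (fun X θ ↦ (∃ A₀ : AbelianVariety ℂ, A₀.dim = 6 ∧ IsDivisorGenerated A₀ ∧ Nonempty (A₀.X ≅ X)) ∧ IsPolarizationClass 6 X θ)
      (fun X _ ↦ (algebraicClasses X 3 : Set (complexBetti X (2 * 3)))))
    (hR : LefAtExceptionalRegimeAtUnder (Literature.AlgebraicGeometry.HodgeTheory.twistedReflexiveClass C
        (fun n X₀ I E => Summit.Ventures.HSemireg.gluableSigmaAdmissible n X₀ I E ∨
          Literature.AlgebraicGeometry.HodgeTheory.bfSingleAdmissible' n X₀ I E)) 6 3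
      (fun _ S f W ↦ ¬ HasServedFibre 6 3 (fun X θ ↦ secantQuotientAnchorsPinned X θ)
          (fun X θ ↦ secantQuotientServedClassesPinned X θ) f W ∧
        ¬ ∃ (t : ComplexPoints S) (A₀ E₀ : AbelianVariety ℂ) (N : ℕ),
          A₀.dim = 6 ∧ E₀.dim = 1 ∧ A₀.IsIsogenous (E₀.powSucc N) ∧ Nonempty (A₀.X ≅ fiberOver f t))) :
    SecantQuotientResidual63PinnedPrime C :=
  secantQuotientResidual63PinnedPrime_of_lefschetzCarrierAt_of_under_not_not hL (under_notLefschetz_of_under_notEllipticPower hR)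

/-- **THE PRIMED `(6,3)` RUNG from (a″′), primed Lefschetz-fibre carriers and the doubly residual at `tw C AdmTw′`** (b06 g121's glue
`lefAtExceptionalRegimeSixfoldMiddle_twPrime_of_pinnedPrime`). [cite: Markman2025SecantWeil, Thm. 1.4.1 and Thm. 1.5.1]
[cite: vanGeemen1994HodgeAV, Thm. 4.11] [cite: Bloch1972Semiregularity, Remark (7.5)] -/
theorem rung_sixfoldMiddleTwPrime_of_anchorCarrier63PinnedPrime_of_lefschetzCarrierAt_of_under_not_not
    (hA : SecantQuotientAnchorCarrier63PinnedPrime C)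
    (hL : AnchoredCarrierAt (Literature.AlgebraicGeometry.HodgeTheory.twistedReflexiveClass C
        (fun n X₀ I E => Summit.Ventures.HSemireg.gluableSigmaAdmissible n X₀ I E ∨
          Literature.AlgebraicGeometry.HodgeTheory.bfSingleAdmissible' n X₀ I E)) 6 3
      (fun X θ ↦ (∃ A₀ : AbelianVariety ℂ, A₀.dim = 6 ∧ IsDivisorGenerated A₀ ∧ Nonempty (A₀.X ≅ X)) ∧ IsPolarizationClass 6 X θ)
      (fun X _ ↦ (algebraicClasses X 3 : Set (complexBetti X (2 * 3)))))
    (hR : LefAtExceptionalRegimeAtUnder (Literature.AlgebraicGeometry.HodgeTheory.twistedReflexiveClass C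
        (fun n X₀ I E => Summit.Ventures.HSemireg.gluableSigmaAdmissible n X₀ I E ∨
          Literature.AlgebraicGeometry.HodgeTheory.bfSingleAdmissible' n X₀ I E)) 6 3
      (fun _ S f W ↦ ¬ HasServedFibre 6 3 (fun X θ ↦ secantQuotientAnchorsPinned X θ)
          (fun X θ ↦ secantQuotientServedClassesPinned X θ) f W ∧
        ¬ ∃ (t : ComplexPoints S) (A₀ E₀ : AbelianVariety ℂ) (N : ℕ),
          A₀.dim = 6 ∧ E₀.dim = 1 ∧ A₀.IsIsogenous (E₀.powSucc N) ∧ Nonempty (A₀.X ≅ fiberOver f t))) :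
    LefAtExceptionalRegimeSixfoldMiddle (Literature.AlgebraicGeometry.HodgeTheory.twistedReflexiveClass C
      (fun n X₀ I E => Summit.Ventures.HSemireg.gluableSigmaAdmissible n X₀ I E ∨
        Literature.AlgebraicGeometry.HodgeTheory.bfSingleAdmissible' n X₀ I E)) :=
  lefAtExceptionalRegimeSixfoldMiddle_twPrime_of_pinnedPrime hA
    (secantQuotientResidual63PinnedPrime_of_lefschetzCarrierAt_of_under_not_notEllipticPower hL hR)

/-- **The primed pair also serves the ASIDE item** (stmt-HodgeConjecture-19787's (b″) of record): primed elliptic-power carriers ∧ the doubly residual at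
`tw C AdmTw′` ⟹ `SecantQuotientResidual63Pinned C`, by b06 g121's comparison `secantQuotientResidual63Pinned_of_prime` ((b″′) ⟹ (b″)). The converse
direction (serving the primed item from `AdmTw`-data) is NOT available: that is the content of the re-key. [cite: BuchweitzFlenner2003, §5 Thm. 5.1]
[cite: vanGeemen1994HodgeAV, §2.4 and Thm. 4.11] [cite: Bloch1972Semiregularity, Remark (7.5)] -/
theorem secantQuotientResidual63Pinned_of_ellipticPowerCarrierAt_admTw'_of_under_not_not
    (hE : AnchoredCarrierAt (Literature.AlgebraicGeometry.HodgeTheory.twistedReflexiveClass C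
        (fun n X₀ I E => Summit.Ventures.HSemireg.gluableSigmaAdmissible n X₀ I E ∨
          Literature.AlgebraicGeometry.HodgeTheory.bfSingleAdmissible' n X₀ I E)) 6 3
      (fun X θ ↦ (∃ (A₀ E₀ : AbelianVariety ℂ) (N : ℕ), A₀.dim = 6 ∧ E₀.dim = 1 ∧ A₀.IsIsogenous (E₀.powSucc N) ∧
        Nonempty (A₀.X ≅ X)) ∧ IsPolarizationClass 6 X θ)
      (fun X _ ↦ (algebraicClasses X 3 : Set (complexBetti X (2 * 3)))))
    (hR : LefAtExceptionalRegimeAtUnder (Literature.AlgebraicGeometry.HodgeTheory.twistedReflexiveClass C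
        (fun n X₀ I E => Summit.Ventures.HSemireg.gluableSigmaAdmissible n X₀ I E ∨
          Literature.AlgebraicGeometry.HodgeTheory.bfSingleAdmissible' n X₀ I E)) 6 3
      (fun _ S f W ↦ ¬ HasServedFibre 6 3 (fun X θ ↦ secantQuotientAnchorsPinned X θ)
          (fun X θ ↦ secantQuotientServedClassesPinned X θ) f W ∧
        ¬ ∃ (t : ComplexPoints S) (A₀ E₀ : AbelianVariety ℂ) (N : ℕ),
          A₀.dim = 6 ∧ E₀.dim = 1 ∧ A₀.IsIsogenous (E₀.powSucc N) ∧ Nonempty (A₀.X ≅ fiberOver f t))) :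
    SecantQuotientResidual63Pinned C :=
  secantQuotientResidual63Pinned_of_prime (secantQuotientResidual63PinnedPrime_of_ellipticPowerCarrierAt_of_under_not_not hE hR)

end Residual

end Summit.HodgeConjecture.HodgeConjecture.Ring2.SemiregularRepresentatives

end
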